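import Mathlib.Data.Nat.Choose.Basic
import Mathlib.Algebra.BigOperators.Intervals
import Mathlib.Algebra.Order.BigOperators.Group.Finset
import Mathlib.Order.Interval.Finset.Nat
import Mathlib.Tactic.Ring
import HarnessLib

/-!
# Macaulay representations of natural numbers (binomial expansions `a = Σ C(k(i), i)`)

Topic: `Literature/RingTheory/GradedAlgebra`. The numerical backbone of Macaulay's theorem on
Hilbert functions (Bruns–Herzog, *Cohen–Macaulay rings*, §4.2): for every `d ≥ 1`, every
`a ∈ ℕ` has a unique expansion

  `a = C(k(d), d) + C(k(d-1), d-1) + ⋯ + C(k(1), 1)`, `k(d) > k(d-1) > ⋯ > k(1) ≥ 0`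

(Lemma 4.2.6, the *`d`-th Macaulay representation*, `k(i)` the *Macaulay coefficients*); the
representation is strictly monotone for the lexicographic order of the coefficient vectors read
from the top (Lemma 4.2.7); and the two operators built from it,

  `a^⟨d⟩ = Σ C(k(i) + 1, i + 1)`   and   `a_⟨d⟩ = Σ C(k(i) - 1, i)`,

are monotone in `a` (Lemma 4.2.13 (a), Lemma 4.2.11 (a)). These are the operators of Macaulay's
bound `H(R, n+1) ≤ H(R, n)^⟨n⟩` (Thm. 4.2.10 (c)) and of Green's hyperplane restriction theorem
`H(R/hR, n) ≤ H(R, n)_⟨n⟩` (Thm. 4.2.12); this file proves only the numerics.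

Rendering: a coefficient vector is a function `k : ℕ → ℕ` read on the indices `1, …, d`
(values elsewhere are ignored); `Macaulay.val d k = Σ_{i ∈ [1, d]} C(k i, i)`;
`Macaulay.IsRep d a k` says `k` is strictly increasing on `[1, d]` (i.e. `k(d) > ⋯ > k(1)`) with
value `a`. The greedy coefficients are `Macaulay.coeff d a` (top coefficient `Macaulay.top d a`,
"the maximal `j` with `C(j, d) ≤ a`"), and `Macaulay.upper d a = a^⟨d⟩`,
`Macaulay.lower d a = a_⟨d⟩`.

* `Macaulay.val_lt_choose_succ` — the engine: `Σ_{i ≤ d} C(k(i), i) < C(k(d) + 1, d)`;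
* `Macaulay.isRep_coeff` (existence) and `Macaulay.IsRep.eq_of_isRep` (uniqueness) — Lemma 4.2.6;
* `Macaulay.IsRep.val_lt_iff` — Lemma 4.2.7 (value order = lexicographic order from the top);
* `Macaulay.IsRep.upper_eq`, `Macaulay.IsRep.lower_eq` — `a^⟨d⟩`, `a_⟨d⟩` computed from ANY
  representation; `Macaulay.upper_mono` (4.2.13 (a)), `Macaulay.lower_mono` (4.2.11 (a));
* `Macaulay.IsRep.upper_succ_eq` — Lemma 4.2.13 (b) (`(a+1)^⟨d⟩ = a^⟨d⟩ + k(1) + 1` when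
  `k(1) ≥ 1`); `Macaulay.IsRep.lower_pred_add_one` — Lemma 4.2.11 (b);
* `Macaulay.le_lower_of_le_lower_add_lower` — the numerical lemma closing the proof of Green's
  theorem (4.2.12): `b ≤ b_⟨n⟩ + (a-b)_⟨n-1⟩ ⇒ b ≤ a_⟨n⟩`;
* `Macaulay.gotzmann`, `Macaulay.upper_gotzmann`, `Macaulay.lower_gotzmann` — for a numerical
  polynomial in Gotzmann form `P(n) = Σ C(n + aᵢ - (i-1), aᵢ)` (`a₁ ≥ ⋯ ≥ a_s`, `s ≤ n`):
  `P(n)^⟨n⟩ = P(n+1)` (the identity behind Cor. 4.2.14 / Thm. 4.3.2) and `P(n)_⟨n⟩`.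

## References

* W. Bruns, J. Herzog, *Cohen–Macaulay rings*, rev. ed., Cambridge Stud. Adv. Math. 39 (1998),
  §4.2: Lemma 4.2.6, Lemma 4.2.7, the definitions of `a^⟨d⟩` (before Prop. 4.2.8) and `a_⟨d⟩`
  (before Lemma 4.2.11), Lemma 4.2.11, Thm. 4.2.12 (proof, last paragraph), Lemma 4.2.13,
  Cor. 4.2.14; §4.3: Thm. 4.3.2 (statement and proof). [BrunsHerzog1998]
-/

open Finset

namespace Literature.RingTheory.GradedAlgebra

namespace Macaulay

/-! ## Values of coefficient vectors -/

/-- The value `Σ_{i ∈ [1, d]} C(k i, i)` of the coefficient vector `k` read on `1, …, d`.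
[cite: BrunsHerzog1998, Lemma 4.2.6] -/
def val (d : ℕ) (k : ℕ → ℕ) : ℕ := ∑ i ∈ Icc 1 d, (k i).choose i

/-- `val 0 k = 0` (empty sum). [cite: BrunsHerzog1998, Lemma 4.2.6] -/
@[simp] theorem val_zero (k : ℕ → ℕ) : val 0 k = 0 := by
  simp [val]

/-- Peeling off the top term of the Macaulay sum: `val (d+1) k = C(k (d+1), d+1) + val d k`.
[cite: BrunsHerzog1998, Lemma 4.2.6] -/
theorem val_succ (d : ℕ) (k : ℕ → ℕ) : val (d + 1) k = (k (d + 1)).choose (d + 1) + val d k := by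
  rw [val, val, Finset.sum_Icc_succ_top (by omega), add_comm]

/-- The Macaulay sum only depends on the coefficients on `[1, d]`. [cite: BrunsHerzog1998, Lemma 4.2.6] -/
theorem val_congr {d : ℕ} {k k' : ℕ → ℕ} (h : ∀ i ∈ Icc 1 d, k i = k' i) : val d k = val d k' :=
  Finset.sum_congr rfl fun i hi => by rw [h i hi]

/-- **`k` is a `d`-th Macaulay representation of `a`**: `k(1) < k(2) < ⋯ < k(d)` and
`Σ_{i=1}^{d} C(k(i), i) = a` (terms with `k(i) < i` are allowed and vanish).
[cite: BrunsHerzog1998, Lemma 4.2.6] -/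
structure IsRep (d a : ℕ) (k : ℕ → ℕ) : Prop where
  /-- strictly increasing on `[1, d]` -/
  lt : ∀ i, 1 ≤ i → i < d → k i < k (i + 1)
  /-- the value is `a` -/
  val_eq : val d k = a

/-- Restricting a representation to the indices `1, …, d` below the top (the induction of
Bruns–Herzog's proof of Lemma 4.2.6). [cite: BrunsHerzog1998, Lemma 4.2.6 (proof)] -/
theorem IsRep.restrict {d a : ℕ} {k : ℕ → ℕ} (h : IsRep (d + 1) a k) :
    IsRep d (a - (k (d + 1)).choose (d + 1)) k where
  lt i hi hid := h.lt i hi (by omega)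
  val_eq := by
    have := h.val_eq
    rw [val_succ] at this
    omega

/-- In a representation the coefficients increase by at least the index gap:
`k i + (j - i) ≤ k j` for `1 ≤ i ≤ j ≤ d` (`k(d) > k(d-1) > ⋯ > k(1)`). [cite: BrunsHerzog1998, Lemma 4.2.6] -/
theorem IsRep.add_le {d a : ℕ} {k : ℕ → ℕ} (h : IsRep d a k) {i j : ℕ} (hi : 1 ≤ i) (hij : i ≤ j)
    (hj : j ≤ d) : k i + (j - i) ≤ k j := by
  induction j, hij using Nat.le_induction with
  | base => simp
  | succ j hij ih =>
    have := h.lt j (by omega) (by omega)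
    have := ih (by omega)
    omega

/-! ## The engine: `Σ_{i ≤ d} C(k(i), i) < C(k(d) + 1, d)` -/

/-- **The engine of the Macaulay calculus**: if `k(1) < ⋯ < k(d)` (`d ≥ 1`) then
`Σ_{i=1}^{d} C(k(i), i) < C(k(d) + 1, d)` (by Pascal's rule and induction; Bruns–Herzog, proof
of Lemma 4.2.6). [cite: BrunsHerzog1998, Lemma 4.2.6 (proof)] -/
theorem val_lt_choose_succ {d : ℕ} (hd : 1 ≤ d) {k : ℕ → ℕ}
    (hk : ∀ i, 1 ≤ i → i < d → k i < k (i + 1)) : val d k < (k d + 1).choose d := by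
  induction d, hd using Nat.le_induction with
  | base => simp [val]
  | succ d hd ih =>
    rw [val_succ, Nat.choose_succ_succ', add_comm ((k (d + 1)).choose d)]
    refine Nat.add_lt_add_left ?_ _
    have h1 : val d k < (k d + 1).choose d := ih fun i hi hid => hk i hi (by omega)
    have h2 : (k d + 1).choose d ≤ (k (d + 1)).choose d :=
      Nat.choose_le_choose d (hk d hd (by omega))
    omega

/-- Variant: the value is below `C(c, d)` for every `c > k(d)`. [cite: BrunsHerzog1998, Lemma 4.2.6 (proof)] -/
theorem val_lt_choose_of_lt {d : ℕ} (hd : 1 ≤ d) {k : ℕ → ℕ}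
    (hk : ∀ i, 1 ≤ i → i < d → k i < k (i + 1)) {c : ℕ} (hc : k d < c) : val d k < c.choose d :=
  (val_lt_choose_succ hd hk).trans_le (Nat.choose_le_choose d hc)

/-! ## Lemma 4.2.7: the value order is the lexicographic order from the top -/

/-- **Lemma 4.2.7, strict half**: if two representations agree above the index `i ∈ [1, d]` and
`k i < k' i`, then `val d k < val d k'`. [cite: BrunsHerzog1998, Lemma 4.2.7] -/
theorem val_lt_val_of_lex {d : ℕ} {k k' : ℕ → ℕ}
    (hk : ∀ i, 1 ≤ i → i < d → k i < k (i + 1)) {i : ℕ} (hi : 1 ≤ i) (hid : i ≤ d)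
    (hlt : k i < k' i) (heq : ∀ j, i < j → j ≤ d → k j = k' j) : val d k < val d k' := by
  induction d, hid using Nat.le_induction with
  | base =>
    -- `i = d`: `val i k < C(k' i, i) ≤ val i k'`
    rcases Nat.exists_eq_add_of_le hi with ⟨i, rfl⟩
    rw [add_comm] at *
    rw [val_succ, val_succ]
    have h1 : val i k < (k (i + 1) + 1).choose (i + 1) - (k (i + 1)).choose (i + 1) := by
      have := val_lt_choose_succ (d := i + 1) (by omega) hk
      rw [val_succ] at this
      omega
    have h2 : (k (i + 1) + 1).choose (i + 1) ≤ (k' (i + 1)).choose (i + 1) :=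
      Nat.choose_le_choose _ hlt
    omega
  | succ d hid ih =>
    rw [val_succ, val_succ, heq (d + 1) (by omega) le_rfl]
    exact Nat.add_lt_add_left (ih (fun j hj hjd => hk j hj (by omega))
      (fun j hij hjd => heq j hij (by omega))) _

/-- **Lemma 4.2.7**: for two `d`-th Macaulay representations, `val k < val k'` iff the
coefficient vectors compare lexicographically from the top: there is an index `i ∈ [1, d]` with
`k i < k' i` and `k j = k' j` for `i < j ≤ d`. [cite: BrunsHerzog1998, Lemma 4.2.7] -/
theorem val_lt_val_iff_lex {d : ℕ} {k k' : ℕ → ℕ}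
    (hk : ∀ i, 1 ≤ i → i < d → k i < k (i + 1)) (hk' : ∀ i, 1 ≤ i → i < d → k' i < k' (i + 1)) :
    val d k < val d k' ↔ ∃ i, 1 ≤ i ∧ i ≤ d ∧ k i < k' i ∧ ∀ j, i < j → j ≤ d → k j = k' j := by
  constructor
  · intro hlt
    -- if the vectors agree on `[1, d]` the values agree; otherwise take the largest index of
    -- disagreement
    by_contra hne
    push Not at hne
    by_cases hagree : ∀ j, 1 ≤ j → j ≤ d → k j = k' j
    · exact absurd (val_congr (d := d) fun j hj => hagree j (mem_Icc.mp hj).1 (mem_Icc.mp hj).2)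
        hlt.ne
    push Not at hagree
    -- the largest disagreement index
    classical
    let S := (Icc 1 d).filter fun j => k j ≠ k' j
    have hS : S.Nonempty := by
      obtain ⟨j, hj1, hjd, hj⟩ := hagree
      exact ⟨j, mem_filter.mpr ⟨mem_Icc.mpr ⟨hj1, hjd⟩, hj⟩⟩
    set i := S.max' hS with hi_def
    have hiS : i ∈ S := S.max'_mem hS
    have hi1 : 1 ≤ i := (mem_Icc.mp (mem_filter.mp hiS).1).1
    have hid : i ≤ d := (mem_Icc.mp (mem_filter.mp hiS).1).2
    have hne_i : k i ≠ k' i := (mem_filter.mp hiS).2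
    have habove : ∀ j, i < j → j ≤ d → k j = k' j := by
      intro j hij hjd
      by_contra hj
      have : j ≤ i := S.le_max' j (mem_filter.mpr ⟨mem_Icc.mpr ⟨by omega, hjd⟩, hj⟩)
      omega
    rcases lt_or_gt_of_ne hne_i with h | h
    · obtain ⟨j, hij, hjd, hj⟩ := hne i hi1 hid h
      exact hj (habove j hij hjd)
    · -- `k' i < k i` forces `val k' < val k`, contradiction
      have := val_lt_val_of_lex hk' hi1 hid h fun j hij hjd => (habove j hij hjd).symm
      omega
  · rintro ⟨i, hi1, hid, hlt, heq⟩
    exact val_lt_val_of_lex hk hi1 hid hlt heq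

/-- **Lemma 4.2.6, uniqueness**: two `d`-th Macaulay representations of the same number have the
same coefficients on `[1, d]`. [cite: BrunsHerzog1998, Lemma 4.2.6] -/
theorem IsRep.eq_of_isRep {d a : ℕ} {k k' : ℕ → ℕ} (h : IsRep d a k) (h' : IsRep d a k') :
    ∀ i, 1 ≤ i → i ≤ d → k i = k' i := by
  by_contra hne
  push Not at hne
  classical
  let S := (Icc 1 d).filter fun j => k j ≠ k' j
  have hS : S.Nonempty := by
    obtain ⟨j, hj1, hjd, hj⟩ := hne
    exact ⟨j, mem_filter.mpr ⟨mem_Icc.mpr ⟨hj1, hjd⟩, hj⟩⟩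
  set i := S.max' hS
  have hiS : i ∈ S := S.max'_mem hS
  have hi1 : 1 ≤ i := (mem_Icc.mp (mem_filter.mp hiS).1).1
  have hid : i ≤ d := (mem_Icc.mp (mem_filter.mp hiS).1).2
  have hne_i : k i ≠ k' i := (mem_filter.mp hiS).2
  have habove : ∀ j, i < j → j ≤ d → k j = k' j := by
    intro j hij hjd
    by_contra hj
    have : j ≤ i := S.le_max' j (mem_filter.mpr ⟨mem_Icc.mpr ⟨by omega, hjd⟩, hj⟩)
    omega
  have hval : val d k = val d k' := by rw [h.val_eq, h'.val_eq]
  rcases lt_or_gt_of_ne hne_i with hlt | hlt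
  · exact absurd hval (val_lt_val_of_lex h.lt hi1 hid hlt habove).ne
  · exact absurd hval.symm
      (val_lt_val_of_lex h'.lt hi1 hid hlt fun j hij hjd => (habove j hij hjd).symm).ne

/-- Monotonicity read off representations: `a ≤ a'` iff NOT (`k'` lexicographically below `k`).
Stated as: if `val k ≤ val k'` then there is no index `i` with `k' i < k i` and agreement above.
[cite: BrunsHerzog1998, Lemma 4.2.7] -/
theorem not_lex_of_val_le {d : ℕ} {k k' : ℕ → ℕ}
    (hk' : ∀ i, 1 ≤ i → i < d → k' i < k' (i + 1)) (hle : val d k ≤ val d k') {i : ℕ}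
    (hi1 : 1 ≤ i) (hid : i ≤ d) (heq : ∀ j, i < j → j ≤ d → k j = k' j) : k i ≤ k' i := by
  by_contra hlt
  push Not at hlt
  have := val_lt_val_of_lex hk' hi1 hid hlt fun j hij hjd => (heq j hij hjd).symm
  omega

/-- **Pointwise criterion for `val k ≤ val k'`**: if at every index `i ∈ [1, d]` above which
the two representations agree one has `k i ≤ k' i`, then `val d k ≤ val d k'` (contrapositive
of Lemma 4.2.7). [cite: BrunsHerzog1998, Lemma 4.2.7] -/
theorem val_le_val_of_forall {d : ℕ} {k k' : ℕ → ℕ}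
    (hk : ∀ i, 1 ≤ i → i < d → k i < k (i + 1)) (hk' : ∀ i, 1 ≤ i → i < d → k' i < k' (i + 1))
    (h : ∀ i, 1 ≤ i → i ≤ d → (∀ j, i < j → j ≤ d → k j = k' j) → k i ≤ k' i) :
    val d k ≤ val d k' := by
  by_contra hlt
  push Not at hlt
  obtain ⟨i, hi1, hid, hlt, heq⟩ := (val_lt_val_iff_lex hk' hk).mp hlt
  have := h i hi1 hid fun j hij hjd => (heq j hij hjd).symm
  omega

/-! ## Lemma 4.2.6, existence: the greedy coefficients -/

/-- `a + 1 ≤ C(a + d, d)` for `d ≥ 1`. [folklore] -/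
private theorem succ_le_choose_add (a : ℕ) {d : ℕ} (hd : 1 ≤ d) : a + 1 ≤ (a + d).choose d := by
  induction a with
  | zero => simp
  | succ a ih =>
    rcases Nat.exists_eq_add_of_le hd with ⟨d, rfl⟩
    have h1 : (a + 1 + (1 + d)).choose (1 + d) =
        (a + (1 + d)).choose d + (a + (1 + d)).choose (1 + d) := by
      rw [show a + 1 + (1 + d) = (a + (1 + d)) + 1 by omega, show 1 + d = d + 1 by omega,
        Nat.choose_succ_succ']
    have h2 : 0 < (a + (1 + d)).choose d := Nat.choose_pos (by omega)
    omega

/-- **The top Macaulay coefficient** `k(d)` of `a`: the largest `j` with `C(j, d) ≤ a`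
(searched below the bound `a + d`, which suffices as `C(a + d, d) > a`).
[cite: BrunsHerzog1998, Lemma 4.2.6 (proof)] -/
def top (d a : ℕ) : ℕ := Nat.findGreatest (fun j => j.choose d ≤ a) (a + d)

/-- `C(top, d) ≤ a`. [cite: BrunsHerzog1998, Lemma 4.2.6 (proof)] -/
theorem choose_top_le {d : ℕ} (hd : 1 ≤ d) (a : ℕ) : (top d a).choose d ≤ a :=
  Nat.findGreatest_spec (P := fun j => j.choose d ≤ a) (Nat.zero_le _)
    (by rw [Nat.choose_eq_zero_of_lt (by omega)]; exact Nat.zero_le _)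

/-- `top d a < a + d` (the search bound is not attained). [folklore] -/
private theorem top_lt {d : ℕ} (hd : 1 ≤ d) (a : ℕ) : top d a < a + d := by
  have hle : top d a ≤ a + d := Nat.findGreatest_le _
  rcases hle.lt_or_eq with h | h
  · exact h
  · exfalso
    have h1 := choose_top_le hd a
    rw [h] at h1
    have h2 := succ_le_choose_add a hd
    omega

/-- `a < C(top + 1, d)`: maximality of the top coefficient. [cite: BrunsHerzog1998, Lemma 4.2.6 (proof)] -/
theorem lt_choose_top_succ {d : ℕ} (hd : 1 ≤ d) (a : ℕ) : a < (top d a + 1).choose d := by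
  have h := Nat.findGreatest_is_greatest (P := fun j => j.choose d ≤ a) (n := a + d)
    (k := top d a + 1) (Nat.lt_succ_self _) (top_lt hd a)
  push Not at h
  exact h

/-- Characterisation of the top coefficient: `C(j, d) ≤ a < C(j + 1, d)` forces `j = top d a`.
[cite: BrunsHerzog1998, Lemma 4.2.6] -/
theorem top_eq_of_le_of_lt {d : ℕ} (hd : 1 ≤ d) {a j : ℕ} (h1 : j.choose d ≤ a)
    (h2 : a < (j + 1).choose d) : top d a = j := by
  by_contra hne
  rcases lt_or_gt_of_ne hne with h | h
  · -- `top < j`: then `C(top + 1, d) ≤ C(j, d) ≤ a`, contradicting maximality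
    have := lt_choose_top_succ hd a
    have : (top d a + 1).choose d ≤ j.choose d := Nat.choose_le_choose d h
    omega
  · have := choose_top_le hd a
    have : (j + 1).choose d ≤ (top d a).choose d := Nat.choose_le_choose d h
    omega

/-- `top 1 a = a`: the first Macaulay representation is `a = C(a, 1)`. [cite: BrunsHerzog1998, Lemma 4.2.6] -/
@[simp] theorem top_one (a : ℕ) : top 1 a = a :=
  top_eq_of_le_of_lt le_rfl (by simp) (by simp)

/-- **The greedy Macaulay coefficients** `coeff d a : ℕ → ℕ` (read on `1, …, d`): the top one is
`top d a`, the others are the coefficients of `a - C(top, d)` for `d - 1`.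
[cite: BrunsHerzog1998, Lemma 4.2.6 (proof)] -/
def coeff : ℕ → ℕ → ℕ → ℕ
  | 0, _, _ => 0
  | d + 1, a, i => if i = d + 1 then top (d + 1) a else coeff d (a - (top (d + 1) a).choose (d + 1)) i

/-- The top greedy coefficient is `top`. [cite: BrunsHerzog1998, Lemma 4.2.6 (proof)] -/
theorem coeff_succ_self (d a : ℕ) : coeff (d + 1) a (d + 1) = top (d + 1) a := by
  simp [coeff]

/-- The top greedy coefficient is `top`, for `d ≥ 1`. [cite: BrunsHerzog1998, Lemma 4.2.6 (proof)] -/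
theorem coeff_self {d : ℕ} (hd : 1 ≤ d) (a : ℕ) : coeff d a d = top d a := by
  obtain ⟨e, rfl⟩ : ∃ e, d = e + 1 := ⟨d - 1, by omega⟩
  exact coeff_succ_self e a

/-- The lower greedy coefficients are those of `a - C(top, d)`. [cite: BrunsHerzog1998, Lemma 4.2.6 (proof)] -/
theorem coeff_succ_of_ne {d a i : ℕ} (hi : i ≠ d + 1) :
    coeff (d + 1) a i = coeff d (a - (top (d + 1) a).choose (d + 1)) i := by
  simp [coeff, hi]

/-- **Lemma 4.2.6, existence**: for `d ≥ 1` the greedy coefficients form a `d`-th Macaulay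
representation of `a`. [cite: BrunsHerzog1998, Lemma 4.2.6] -/
theorem isRep_coeff {d : ℕ} (hd : 1 ≤ d) (a : ℕ) : IsRep d a (coeff d a) := by
  induction d, hd using Nat.le_induction generalizing a with
  | base =>
    refine ⟨fun i hi hid => by omega, ?_⟩
    simp [val, coeff]
  | succ d hd ih =>
    set a' := a - (top (d + 1) a).choose (d + 1) with ha'
    have ih' := ih a'
    -- the representation below the top is that of `a'`
    have hval : val d (coeff (d + 1) a) = val d (coeff d a') :=
      val_congr fun i hi => coeff_succ_of_ne (by have := (mem_Icc.mp hi).2; omega)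
    refine ⟨fun i hi hid => ?_, ?_⟩
    · rcases Nat.lt_or_ge i d with hlt | hge
      · rw [coeff_succ_of_ne (by omega), coeff_succ_of_ne (by omega)]
        exact ih'.lt i hi hlt
      · -- `i = d`: the top coefficient of `a'` is below the top coefficient of `a`
        obtain rfl : i = d := by omega
        rw [coeff_succ_self, coeff_succ_of_ne (by omega), coeff_self hd]
        -- `C(top i a', i) ≤ a' < C(top (i+1) a, i)`
        have h1 : (top i a').choose i ≤ a' := choose_top_le hd a'
        have h4 : (top (i + 1) a).choose (i + 1) ≤ a := choose_top_le (d := i + 1) (by omega) a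
        have h3 : a < (top (i + 1) a).choose i + (top (i + 1) a).choose (i + 1) := by
          have := lt_choose_top_succ (d := i + 1) (by omega) a
          rwa [Nat.choose_succ_succ' (top (i + 1) a) i] at this
        have h2 : a' < (top (i + 1) a).choose i := by rw [ha']; omega
        by_contra hle
        push Not at hle
        have : (top (i + 1) a).choose i ≤ (top i a').choose i := Nat.choose_le_choose _ hle
        omega
    · rw [val_succ, coeff_succ_self, hval, ih'.val_eq, ha']
      have := choose_top_le (d := d + 1) (by omega) a
      omega

/-- Hence every `a` has a `d`-th Macaulay representation (`d ≥ 1`).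
[cite: BrunsHerzog1998, Lemma 4.2.6] -/
theorem exists_isRep {d : ℕ} (hd : 1 ≤ d) (a : ℕ) : ∃ k, IsRep d a k :=
  ⟨_, isRep_coeff hd a⟩

/-- The coefficients of a representation ARE the greedy ones. [cite: BrunsHerzog1998, Lemma 4.2.6] -/
theorem IsRep.eq_coeff {d a : ℕ} {k : ℕ → ℕ} (h : IsRep d a k) (hd : 1 ≤ d) :
    ∀ i, 1 ≤ i → i ≤ d → k i = coeff d a i :=
  h.eq_of_isRep (isRep_coeff hd a)

/-- In particular the top coefficient of any representation is `top d a`.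
[cite: BrunsHerzog1998, Lemma 4.2.6 (remark after the proof)] -/
theorem IsRep.apply_eq_top {d a : ℕ} {k : ℕ → ℕ} (h : IsRep d a k) (hd : 1 ≤ d) :
    k d = top d a := by
  rw [h.eq_coeff hd d hd le_rfl, coeff_self hd]

/-! ## The operators `a^⟨d⟩` and `a_⟨d⟩` -/

/-- **`a^⟨d⟩ = Σ C(k(i) + 1, i + 1)`** for the `d`-th Macaulay coefficients `k(i)` of `a`
(Bruns–Herzog, before Prop. 4.2.8; `0^⟨d⟩ = 0`). The bound in Macaulay's theorem
`H(R, n+1) ≤ H(R, n)^⟨n⟩`. [cite: BrunsHerzog1998, §4.2 (definition before Prop. 4.2.8)] -/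
def upper (d a : ℕ) : ℕ := ∑ i ∈ Icc 1 d, (coeff d a i + 1).choose (i + 1)

/-- **`a_⟨d⟩ = Σ C(k(i) - 1, i)`** for the `d`-th Macaulay coefficients `k(i)` of `a`
(Bruns–Herzog, before Lemma 4.2.11). The bound in Green's theorem `H(R/hR, n) ≤ H(R, n)_⟨n⟩`.
[cite: BrunsHerzog1998, §4.2 (definition before Lemma 4.2.11)] -/
def lower (d a : ℕ) : ℕ := ∑ i ∈ Icc 1 d, (coeff d a i - 1).choose i

/-- `a^⟨d⟩` may be computed from ANY `d`-th Macaulay representation of `a`.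
[cite: BrunsHerzog1998, Lemma 4.2.6] -/
theorem IsRep.upper_eq {d a : ℕ} {k : ℕ → ℕ} (h : IsRep d a k) :
    upper d a = ∑ i ∈ Icc 1 d, (k i + 1).choose (i + 1) := by
  rcases Nat.eq_zero_or_pos d with rfl | hd
  · simp [upper]
  · exact Finset.sum_congr rfl fun i hi =>
      by rw [h.eq_coeff hd i (mem_Icc.mp hi).1 (mem_Icc.mp hi).2]

/-- `a_⟨d⟩` may be computed from ANY `d`-th Macaulay representation of `a`.
[cite: BrunsHerzog1998, Lemma 4.2.6] -/
theorem IsRep.lower_eq {d a : ℕ} {k : ℕ → ℕ} (h : IsRep d a k) :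
    lower d a = ∑ i ∈ Icc 1 d, (k i - 1).choose i := by
  rcases Nat.eq_zero_or_pos d with rfl | hd
  · simp [lower]
  · exact Finset.sum_congr rfl fun i hi =>
      by rw [h.eq_coeff hd i (mem_Icc.mp hi).1 (mem_Icc.mp hi).2]

/-- `0^⟨d⟩ = 0`. [cite: BrunsHerzog1998, §4.2 (definition before Prop. 4.2.8)] -/
theorem upper_zero (d : ℕ) : upper d 0 = 0 := by
  rcases Nat.eq_zero_or_pos d with rfl | hd
  · simp [upper]
  · -- the representation of `0` is `k(i) = i - 1`
    have h : IsRep d 0 fun i => i - 1 :=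
      ⟨fun i hi hid => by omega, Finset.sum_eq_zero fun i hi => by
        have := (mem_Icc.mp hi).1
        exact Nat.choose_eq_zero_of_lt (by dsimp only; omega)⟩
    rw [h.upper_eq]
    exact Finset.sum_eq_zero fun i hi => by
      have := (mem_Icc.mp hi).1
      exact Nat.choose_eq_zero_of_lt (by omega)

/-- `0_⟨d⟩ = 0`. [cite: BrunsHerzog1998, §4.2 (definition before Lemma 4.2.11)] -/
theorem lower_zero (d : ℕ) : lower d 0 = 0 := by
  rcases Nat.eq_zero_or_pos d with rfl | hd
  · simp [lower]
  · have h : IsRep d 0 fun i => i - 1 :=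
      ⟨fun i hi hid => by omega, Finset.sum_eq_zero fun i hi => by
        have := (mem_Icc.mp hi).1
        exact Nat.choose_eq_zero_of_lt (by dsimp only; omega)⟩
    rw [h.lower_eq]
    exact Finset.sum_eq_zero fun i hi => by
      have := (mem_Icc.mp hi).1
      exact Nat.choose_eq_zero_of_lt (by omega)

/-! ### `a^⟨d⟩` as the value of a shifted representation -/

/-- The upward shift of a coefficient vector: `K(1) = 0`, `K(j) = k(j-1) + 1` (`j ≥ 2`). Its value
on `[1, d+1]` is `Σ_{i ≤ d} C(k(i) + 1, i + 1)` and it is again strictly increasing.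
[cite: BrunsHerzog1998, §4.2 (definition before Prop. 4.2.8)] -/
def shiftUp (k : ℕ → ℕ) (j : ℕ) : ℕ := if j = 1 then 0 else k (j - 1) + 1

/-- The value of the upward shift on `[1, d+1]` is `Σ_{i ≤ d} C(k(i) + 1, i + 1)`.
[cite: BrunsHerzog1998, §4.2 (definition before Prop. 4.2.8)] -/
theorem val_shiftUp (d : ℕ) (k : ℕ → ℕ) :
    val (d + 1) (shiftUp k) = ∑ i ∈ Icc 1 d, (k i + 1).choose (i + 1) := by
  induction d with
  | zero => simp [val, shiftUp]
  | succ d ih =>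
    rw [val_succ, ih, Finset.sum_Icc_succ_top (by omega), add_comm]
    simp [shiftUp]

/-- The upward shift of a strictly increasing vector is strictly increasing on `[1, d+1]`, so
that `(0, k(1)+1, …, k(d)+1)` are the `(d+1)`-th Macaulay coefficients of `a^⟨d⟩`.
[cite: BrunsHerzog1998, §4.2 (definition before Prop. 4.2.8)] -/
theorem shiftUp_lt {d : ℕ} {k : ℕ → ℕ} (hk : ∀ i, 1 ≤ i → i < d → k i < k (i + 1)) :
    ∀ i, 1 ≤ i → i < d + 1 → shiftUp k i < shiftUp k (i + 1) := by
  intro i hi hid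
  by_cases h1 : i = 1
  · subst h1; simp [shiftUp]
  · simp only [shiftUp, h1, if_false, show i + 1 ≠ 1 by omega, Nat.add_sub_cancel]
    have := hk (i - 1) (by omega) (by omega)
    rw [show i - 1 + 1 = i by omega] at this
    omega

/-- **Lemma 4.2.13 (a)** (strict form): `a < a'` implies `a^⟨d⟩ < a'^⟨d⟩` (`d ≥ 1`).
[cite: BrunsHerzog1998, Lemma 4.2.13 (a)] -/
theorem upper_lt_upper {d : ℕ} (hd : 1 ≤ d) {a a' : ℕ} (h : a < a') : upper d a < upper d a' := by
  have hk := isRep_coeff hd a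
  have hk' := isRep_coeff hd a'
  rw [hk.upper_eq, hk'.upper_eq, ← val_shiftUp, ← val_shiftUp]
  -- the greedy vectors compare lexicographically; so do their shifts
  have hlt : val d (coeff d a) < val d (coeff d a') := by rw [hk.val_eq, hk'.val_eq]; exact h
  obtain ⟨i, hi1, hid, hlt, heq⟩ := (val_lt_val_iff_lex hk.lt hk'.lt).mp hlt
  refine val_lt_val_of_lex (shiftUp_lt hk.lt) (i := i + 1) (by omega) (by omega) ?_ ?_
  · rw [shiftUp, shiftUp, if_neg (by omega), if_neg (by omega), Nat.add_sub_cancel]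
    exact Nat.succ_lt_succ hlt
  · intro j hij hjd
    rw [shiftUp, shiftUp, if_neg (by omega), if_neg (by omega), heq (j - 1) (by omega) (by omega)]

/-- **Lemma 4.2.13 (a)**: `a ≤ a'` implies `a^⟨d⟩ ≤ a'^⟨d⟩`. [cite: BrunsHerzog1998, Lemma 4.2.13 (a)] -/
theorem upper_mono (d : ℕ) : Monotone (upper d) := by
  rcases Nat.eq_zero_or_pos d with rfl | hd
  · intro a a' _; simp [upper]
  · intro a a' h
    rcases h.lt_or_eq with h | rfl
    · exact (upper_lt_upper hd h).le
    · exact le_rfl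

/-! ### `a_⟨d⟩` as the value of a shifted representation -/

/-- The downward shift of a coefficient vector, normalised as in Bruns–Herzog (remark before
Lemma 4.2.11): `L(i) = k(i) - 1` where `k(i) ≥ i`, and `L(i) = i - 1` (a vanishing term) where
`k(i) < i`. Its value on `[1, d]` is `Σ C(k(i) - 1, i)` and it is again strictly increasing.
[cite: BrunsHerzog1998, §4.2 (remark before Lemma 4.2.11)] -/
def shiftDown (k : ℕ → ℕ) (i : ℕ) : ℕ := if i ≤ k i then k i - 1 else i - 1

/-- The value of the downward shift on `[1, d]` is `Σ C(k(i) - 1, i)`.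
[cite: BrunsHerzog1998, §4.2 (remark before Lemma 4.2.11)] -/
theorem val_shiftDown (d : ℕ) (k : ℕ → ℕ) :
    val d (shiftDown k) = ∑ i ∈ Icc 1 d, (k i - 1).choose i := by
  refine Finset.sum_congr rfl fun i hi => ?_
  have hi1 := (mem_Icc.mp hi).1
  by_cases h : i ≤ k i
  · simp [shiftDown, h]
  · simp only [shiftDown, h, if_false]
    rw [Nat.choose_eq_zero_of_lt (by omega), Nat.choose_eq_zero_of_lt (by omega)]

/-- The downward shift of a strictly increasing vector is strictly increasing: Bruns–Herzog's
remark "`a_⟨d⟩` has `d`-th Macaulay coefficients `k(d)-1, …, k(j)-1, j-2, j-3, …, 0`".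
[cite: BrunsHerzog1998, §4.2 (remark before Lemma 4.2.11)] -/
theorem shiftDown_lt {d : ℕ} {k : ℕ → ℕ} (hk : ∀ i, 1 ≤ i → i < d → k i < k (i + 1)) :
    ∀ i, 1 ≤ i → i < d → shiftDown k i < shiftDown k (i + 1) := by
  intro i hi hid
  have := hk i hi hid
  unfold shiftDown
  split_ifs <;> omega

/-- **Lemma 4.2.11 (a)**: `a ≤ a'` implies `a_⟨d⟩ ≤ a'_⟨d⟩`. [cite: BrunsHerzog1998, Lemma 4.2.11 (a)] -/
theorem lower_mono (d : ℕ) : Monotone (lower d) := by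
  rcases Nat.eq_zero_or_pos d with rfl | hd
  · intro a a' _; simp [lower]
  intro a a' hle
  have hk := isRep_coeff hd a
  have hk' := isRep_coeff hd a'
  set k := coeff d a
  set k' := coeff d a'
  change ∑ i ∈ Icc 1 d, (k i - 1).choose i ≤ ∑ i ∈ Icc 1 d, (k' i - 1).choose i
  rw [← val_shiftDown, ← val_shiftDown]
  have hvle : val d k ≤ val d k' := by rw [hk.val_eq, hk'.val_eq]; exact hle
  refine val_le_val_of_forall (shiftDown_lt hk.lt) (shiftDown_lt hk'.lt) fun i hi1 hid hagree => ?_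
  -- if `k i < i` the shifted coefficient is the minimal possible one
  by_cases hki : i ≤ k i
  swap
  · have : shiftDown k i = i - 1 := by simp [shiftDown, hki]
    rw [this]
    unfold shiftDown
    split_ifs <;> omega
  by_cases hki' : i ≤ k' i
  swap
  · -- `k' i < i ≤ k i` is impossible unless … it forces `val k' < val k` via an index above
    -- in fact we show `k i ≤ k' i` below in general; here it gives `k i ≤ k' i < i ≤ k i`
    exfalso
    -- all indices `j > i` with `k j ≠ k' j`: take the largest; there `k j < k' j`, and both are
    -- `≥ j`, so the shifts differ there, contradicting `hagree`; if none, `k i ≤ k' i`.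
    apply absurd (?_ : k i ≤ k' i) (by omega)
    exact key hk hk' hvle hi1 hid hagree hki
  · simp only [shiftDown, hki, hki', if_true]
    have := key hk hk' hvle hi1 hid hagree hki
    omega
where
  /-- the key step: under agreement of the shifts above `i` and `k i ≥ i`, `k i ≤ k' i` -/
  key {d a a' : ℕ} {k k' : ℕ → ℕ} (hk : IsRep d a k) (hk' : IsRep d a' k')
      (hvle : val d k ≤ val d k') {i : ℕ} (hi1 : 1 ≤ i) (hid : i ≤ d)
      (hagree : ∀ j, i < j → j ≤ d → shiftDown k j = shiftDown k' j) (hki : i ≤ k i) :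
      k i ≤ k' i := by
    classical
    by_contra hlt
    push Not at hlt
    -- there is a disagreement of `k, k'` above `i` (else `not_lex_of_val_le` gives `k i ≤ k' i`)
    by_cases hex : ∃ j, i < j ∧ j ≤ d ∧ k j ≠ k' j
    · let S := (Icc 1 d).filter fun j => i < j ∧ k j ≠ k' j
      have hS : S.Nonempty := by
        obtain ⟨j, hij, hjd, hj⟩ := hex
        exact ⟨j, mem_filter.mpr ⟨mem_Icc.mpr ⟨by omega, hjd⟩, hij, hj⟩⟩
      set j₀ := S.max' hS
      have hjS : j₀ ∈ S := S.max'_mem hS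
      have hj1 : i < j₀ := (mem_filter.mp hjS).2.1
      have hjd : j₀ ≤ d := (mem_Icc.mp (mem_filter.mp hjS).1).2
      have hne : k j₀ ≠ k' j₀ := (mem_filter.mp hjS).2.2
      have habove : ∀ j, j₀ < j → j ≤ d → k j = k' j := by
        intro j hj hjd'
        by_contra hj'
        have : j ≤ j₀ := S.le_max' j (mem_filter.mpr ⟨mem_Icc.mpr ⟨by omega, hjd'⟩, by omega, hj'⟩)
        omega
      have hkj : k j₀ ≤ k' j₀ := not_lex_of_val_le hk'.lt hvle (by omega) hjd habove
      have hkj' : k j₀ < k' j₀ := lt_of_le_of_ne hkj hne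
      -- both coefficients at `j₀` are `≥ j₀`
      have hge : j₀ ≤ k j₀ := by
        have := hk.add_le hi1 hj1.le hjd
        omega
      have hge' : j₀ ≤ k' j₀ := by omega
      have := hagree j₀ hj1 hjd
      simp only [shiftDown, hge, hge', if_true] at this
      omega
    · push Not at hex
      have := not_lex_of_val_le hk'.lt hvle hi1 hid fun j hij hjd => hex j hij hjd
      omega

/-! ## Hockey-stick identities for runs of consecutive coefficients -/

/-- `Σ_{r=1}^{i} C(c + r - 1, r) + 1 = C(c + i, i)` (parallel summation). [folklore] -/
private theorem sum_choose_run (c i : ℕ) :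
    ∑ r ∈ Icc 1 i, (c + r - 1).choose r + 1 = (c + i).choose i := by
  induction i with
  | zero => simp
  | succ i ih =>
    rw [Finset.sum_Icc_succ_top (by omega), add_right_comm, ih,
      show c + (i + 1) - 1 = c + i by omega, show c + (i + 1) = (c + i) + 1 by omega,
      Nat.choose_succ_succ' (c + i) i]

/-- `Σ_{r=1}^{i} C(c + r, r + 1) + (c + 1) = C(c + i + 1, i + 1)`. [folklore] -/
private theorem sum_choose_run_succ (c i : ℕ) :
    ∑ r ∈ Icc 1 i, (c + r).choose (r + 1) + (c + 1) = (c + i + 1).choose (i + 1) := by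
  induction i with
  | zero => simp
  | succ i ih =>
    rw [Finset.sum_Icc_succ_top (by omega), add_right_comm, ih,
      show c + (i + 1) = c + i + 1 by omega, Nat.choose_succ_succ' (c + i + 1) (i + 1)]

/-- Splitting a sum over `[1, d]` at `i ≤ d`. [folklore] -/
private theorem sum_Icc_split {i d : ℕ} (hid : i ≤ d) (g : ℕ → ℕ) :
    ∑ r ∈ Icc 1 d, g r = (∑ r ∈ Icc 1 i, g r) + ∑ r ∈ Icc (i + 1) d, g r := by
  rw [← Finset.sum_union]
  · congr 1
    ext r; simp only [mem_Icc, mem_union]; omega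
  · rw [Finset.disjoint_left]; intro r h1 h2; simp only [mem_Icc] at h1 h2; omega

/-- A sum over `[1, i + 1]` whose terms below `i + 1` vanish. [folklore] -/
private theorem sum_Icc_eq_last {i : ℕ} (g : ℕ → ℕ) (h0 : ∀ r, 1 ≤ r → r ≤ i → g r = 0) :
    ∑ r ∈ Icc 1 (i + 1), g r = g (i + 1) := by
  rw [Finset.sum_Icc_succ_top (by omega), Finset.sum_eq_zero fun r hr =>
    h0 r (mem_Icc.mp hr).1 (mem_Icc.mp hr).2, zero_add]

/-! ## Lemma 4.2.13 (b): `(a+1)^⟨d⟩` when the lowest coefficient is positive -/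

/-- **Lemma 4.2.13 (b), case `j = 1`**: if the `d`-th Macaulay coefficients of `a` satisfy
`k(1) ≥ 1`, then `(a + 1)^⟨d⟩ = a^⟨d⟩ + k(1) + 1`. (Bruns–Herzog: with `i` maximal such that
`k(i) = k(1) + i - 1`, `a + 1 = Σ_{r > i} C(k(r), r) + C(k(1) + i, i)` is the Macaulay
representation of `a + 1`.) [cite: BrunsHerzog1998, Lemma 4.2.13 (b)] -/
theorem IsRep.upper_succ_eq {d a : ℕ} {k : ℕ → ℕ} (h : IsRep d a k) (hd : 1 ≤ d)
    (h1 : 1 ≤ k 1) : upper d (a + 1) = upper d a + k 1 + 1 := by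
  classical
  -- the initial run: a maximal `i ≤ d` with `k r = k 1 + r - 1` for all `r ≤ i`
  obtain ⟨i, hi1, hid, hrun, hjump⟩ : ∃ i, 1 ≤ i ∧ i ≤ d ∧
      (∀ r, 1 ≤ r → r ≤ i → k r = k 1 + r - 1) ∧ (i < d → k 1 + i < k (i + 1)) := by
    let P : ℕ → Prop := fun i => i ≤ d ∧ ∀ r, 1 ≤ r → r ≤ i → k r = k 1 + r - 1
    have hP1 : P 1 := ⟨hd, fun r hr hr1 => by rw [show r = 1 by omega]; omega⟩
    have hPi : P (Nat.findGreatest P d) := Nat.findGreatest_spec hd hP1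
    refine ⟨Nat.findGreatest P d, Nat.le_findGreatest hd hP1, hPi.1, hPi.2, fun hlt => ?_⟩
    have hne : ¬P (Nat.findGreatest P d + 1) :=
      Nat.findGreatest_is_greatest (Nat.lt_succ_self _) (by omega)
    have hlast := hPi.2 (Nat.findGreatest P d) (Nat.le_findGreatest hd hP1) le_rfl
    have hstep := h.lt (Nat.findGreatest P d) (Nat.le_findGreatest hd hP1) hlt
    by_contra hle
    apply hne
    refine ⟨by omega, fun r hr hri => ?_⟩
    rcases Nat.lt_or_ge r (Nat.findGreatest P d + 1) with hlt' | hge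
    · exact hPi.2 r hr (by omega)
    · obtain rfl : r = Nat.findGreatest P d + 1 := by omega
      omega
  obtain ⟨i₀, rfl⟩ : ∃ i₀, i = i₀ + 1 := ⟨i - 1, by omega⟩
  -- the representation of `a + 1`
  let k' : ℕ → ℕ := fun r => if r < i₀ + 1 then r - 1 else if r = i₀ + 1 then k 1 + (i₀ + 1) else k r
  have hk'top : ∀ r, i₀ + 1 < r → k' r = k r := fun r hr => by
    simp only [k', if_neg (show ¬r < i₀ + 1 by omega), if_neg (show r ≠ i₀ + 1 by omega)]
  have hk'mid : k' (i₀ + 1) = k 1 + (i₀ + 1) := by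
    simp only [k', lt_irrefl, if_false, if_true]
  have hk'low : ∀ r, r < i₀ + 1 → k' r = r - 1 := fun r hr => by simp only [k', if_pos hr]
  have hk' : IsRep d (a + 1) k' := by
    refine ⟨fun r hr hrd => ?_, ?_⟩
    · rcases Nat.lt_trichotomy (r + 1) (i₀ + 1) with hlt | heq | hgt
      · rw [hk'low r (by omega), hk'low (r + 1) hlt]; omega
      · rw [hk'low r (by omega), show r + 1 = i₀ + 1 from heq, hk'mid]; omega
      · rcases Nat.lt_or_ge (i₀ + 1) r with hr' | hr'
        · rw [hk'top r hr', hk'top (r + 1) (by omega)]; exact h.lt r hr hrd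
        · obtain rfl : r = i₀ + 1 := by omega
          rw [hk'mid, hk'top _ (by omega)]; exact hjump hrd
    · have hva := h.val_eq
      rw [val, sum_Icc_split hid] at hva
      have htop : ∑ r ∈ Icc (i₀ + 1 + 1) d, (k' r).choose r = ∑ r ∈ Icc (i₀ + 1 + 1) d, (k r).choose r :=
        Finset.sum_congr rfl fun r hr => by rw [hk'top r (by have := (mem_Icc.mp hr).1; omega)]
      rw [val, sum_Icc_split hid, htop]
      -- on the run: `Σ_{r ≤ i} C(k r, r) + 1 = C(k 1 + i, i) = Σ_{r ≤ i} C(k' r, r)`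
      have hrunsum : ∑ r ∈ Icc 1 (i₀ + 1), (k r).choose r + 1 = (k 1 + (i₀ + 1)).choose (i₀ + 1) := by
        rw [Finset.sum_congr rfl fun r hr => by rw [hrun r (mem_Icc.mp hr).1 (mem_Icc.mp hr).2]]
        exact sum_choose_run (k 1) (i₀ + 1)
      have hrunsum' : ∑ r ∈ Icc 1 (i₀ + 1), (k' r).choose r = (k 1 + (i₀ + 1)).choose (i₀ + 1) := by
        rw [sum_Icc_eq_last (fun r => (k' r).choose r) fun r hr hri => by
          rw [hk'low r (by omega)]; exact Nat.choose_eq_zero_of_lt (by omega), hk'mid]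
      rw [hrunsum']
      omega
  -- compare the two upper sums, split at `i`
  have htop : ∑ r ∈ Icc (i₀ + 1 + 1) d, (k' r + 1).choose (r + 1) =
      ∑ r ∈ Icc (i₀ + 1 + 1) d, (k r + 1).choose (r + 1) :=
    Finset.sum_congr rfl fun r hr => by rw [hk'top r (by have := (mem_Icc.mp hr).1; omega)]
  rw [hk'.upper_eq, h.upper_eq, sum_Icc_split hid, sum_Icc_split hid, htop]
  have hrunsum : ∑ r ∈ Icc 1 (i₀ + 1), (k r + 1).choose (r + 1) + (k 1 + 1) =
      (k 1 + (i₀ + 1) + 1).choose (i₀ + 1 + 1) := by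
    rw [Finset.sum_congr rfl fun r hr => by
      rw [hrun r (mem_Icc.mp hr).1 (mem_Icc.mp hr).2,
        show k 1 + r - 1 + 1 = k 1 + r by have := (mem_Icc.mp hr).1; omega]]
    rw [sum_choose_run_succ (k 1) (i₀ + 1), show k 1 + (i₀ + 1) + 1 = k 1 + (i₀ + 1) + 1 from rfl]
  have hrunsum' : ∑ r ∈ Icc 1 (i₀ + 1), (k' r + 1).choose (r + 1) =
      (k 1 + (i₀ + 1) + 1).choose (i₀ + 1 + 1) := by
    rw [sum_Icc_eq_last (fun r => (k' r + 1).choose (r + 1)) fun r hr hri => by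
      rw [hk'low r (by omega)]; exact Nat.choose_eq_zero_of_lt (by omega), hk'mid]
  rw [hrunsum']
  omega

/-! ## Lemma 4.2.11 (b): `(a-1)_⟨d⟩` when the lowest nonvanishing coefficient exceeds its index -/

/-- **Lemma 4.2.11 (b)**: let `k` be the `d`-th Macaulay coefficients of `a`, let `j` be an
index such that the terms below `j` vanish (`k(i) < i` for `i < j`) and `k(j) > j`. Then
`(a - 1)_⟨d⟩ + 1 = a_⟨d⟩`, in particular `(a - 1)_⟨d⟩ < a_⟨d⟩`. (With `c = k(j) - j ≥ 1`:
`a - 1 = Σ_{i > j} C(k(i), i) + Σ_{r ≤ j} C(c + r - 1, r)` is the representation of `a - 1`.)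
[cite: BrunsHerzog1998, Lemma 4.2.11 (b)] -/
theorem IsRep.lower_pred_add_one {d a : ℕ} {k : ℕ → ℕ} (h : IsRep d a k) {j : ℕ} (hj1 : 1 ≤ j)
    (hjd : j ≤ d) (hlow : ∀ i, 1 ≤ i → i < j → k i < i) (hkj : j < k j) :
    lower d (a - 1) + 1 = lower d a := by
  obtain ⟨c, hc⟩ : ∃ c, k j = c + j + 1 := ⟨k j - j - 1, by omega⟩
  -- the representation of `a - 1`: `k' r = c + r` for `r ≤ j`, `k r` above
  let k' : ℕ → ℕ := fun r => if r ≤ j then c + r else k r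
  have hk'top : ∀ r, j < r → k' r = k r := fun r hr => by
    simp only [k', if_neg (show ¬r ≤ j by omega)]
  have hk'low : ∀ r, r ≤ j → k' r = c + r := fun r hr => by simp only [k', if_pos hr]
  obtain ⟨j₀, rfl⟩ : ∃ j₀, j = j₀ + 1 := ⟨j - 1, by omega⟩
  -- the terms of `a` below `j` vanish, the term at `j` is `C(c + j + 1, j)`
  have hlowsum : ∑ r ∈ Icc 1 (j₀ + 1), (k r).choose r = (c + (j₀ + 1) + 1).choose (j₀ + 1) := by
    rw [sum_Icc_eq_last (fun r => (k r).choose r) fun r hr hri =>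
      Nat.choose_eq_zero_of_lt (hlow r hr (by omega)), hc]
  have hlowsum' : ∑ r ∈ Icc 1 (j₀ + 1), (k' r).choose r + 1 = (c + (j₀ + 1) + 1).choose (j₀ + 1) := by
    rw [Finset.sum_congr rfl fun r hr => by
      rw [hk'low r (mem_Icc.mp hr).2, show c + r = (c + 1) + r - 1 by omega]]
    rw [sum_choose_run (c + 1) (j₀ + 1), show c + 1 + (j₀ + 1) = c + (j₀ + 1) + 1 by omega]
  have hk' : IsRep d (a - 1) k' := by
    refine ⟨fun r hr hrd => ?_, ?_⟩
    · rcases Nat.lt_trichotomy r (j₀ + 1) with hlt | heq | hgt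
      · rw [hk'low r hlt.le, hk'low (r + 1) (by omega)]; omega
      · subst heq
        rw [hk'low _ le_rfl, hk'top _ (by omega)]
        have := h.lt (j₀ + 1) hr hrd
        omega
      · rw [hk'top r hgt, hk'top (r + 1) (by omega)]; exact h.lt r hr hrd
    · have hva := h.val_eq
      rw [val, sum_Icc_split hjd, hlowsum] at hva
      have htop : ∑ r ∈ Icc (j₀ + 1 + 1) d, (k' r).choose r = ∑ r ∈ Icc (j₀ + 1 + 1) d, (k r).choose r :=
        Finset.sum_congr rfl fun r hr => by rw [hk'top r (by have := (mem_Icc.mp hr).1; omega)]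
      rw [val, sum_Icc_split hjd, htop]
      have : 1 ≤ (c + (j₀ + 1) + 1).choose (j₀ + 1) := Nat.choose_pos (by omega)
      omega
  -- compare the lower sums, split at `j`
  have htop : ∑ r ∈ Icc (j₀ + 1 + 1) d, (k' r - 1).choose r = ∑ r ∈ Icc (j₀ + 1 + 1) d, (k r - 1).choose r :=
    Finset.sum_congr rfl fun r hr => by rw [hk'top r (by have := (mem_Icc.mp hr).1; omega)]
  rw [hk'.lower_eq, h.lower_eq, sum_Icc_split hjd, sum_Icc_split hjd, htop]
  -- below `j`: for `a`, only the term `C(c + j, j)` at `j`; for `a - 1`, `Σ C(c + r - 1, r)`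
  have hl : ∑ r ∈ Icc 1 (j₀ + 1), (k r - 1).choose r = (c + (j₀ + 1)).choose (j₀ + 1) := by
    rw [sum_Icc_eq_last (fun r => (k r - 1).choose r) fun r hr hri =>
      Nat.choose_eq_zero_of_lt (by have := hlow r hr (by omega); omega), hc,
      show c + (j₀ + 1) + 1 - 1 = c + (j₀ + 1) by omega]
  have hl' : ∑ r ∈ Icc 1 (j₀ + 1), (k' r - 1).choose r + 1 = (c + (j₀ + 1)).choose (j₀ + 1) := by
    rw [Finset.sum_congr rfl fun r hr => by rw [hk'low r (mem_Icc.mp hr).2]]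
    exact sum_choose_run c (j₀ + 1)
  rw [hl]
  omega

/-! ## Green's numerical lemma (Bruns–Herzog, end of the proof of Thm. 4.2.12) -/

/-- Below an index where the coefficient is smaller than the index, all terms vanish and
`k(i) = i - 1` (the remark after Lemma 4.2.7 on skipping zero summands).
[cite: BrunsHerzog1998, Lemma 4.2.7 (remark after the proof)] -/
theorem IsRep.eq_pred_of_lt {d a : ℕ} {k : ℕ → ℕ} (h : IsRep d a k) {j : ℕ} (hjd : j ≤ d)
    (hkj : k j < j) : ∀ i, 1 ≤ i → i ≤ j → k i = i - 1 := by
  intro i hi hij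
  have h1 := h.add_le hi hij hjd
  have h2 := h.add_le le_rfl hi (by omega)
  omega

/-- Shifting a sum over `[1, m]` to `[1, m + 1]` with a vanishing first term. [folklore] -/
private theorem sum_Icc_shift (m : ℕ) (f : ℕ → ℕ) :
    ∑ i ∈ Icc 1 m, f i = ∑ i ∈ Icc 1 (m + 1), (if 1 = i then 0 else f (i - 1)) := by
  induction m with
  | zero => simp
  | succ m ih =>
    rw [Finset.sum_Icc_succ_top (show 1 ≤ m + 1 by omega), ih,
      Finset.sum_Icc_succ_top (show 1 ≤ m + 1 + 1 by omega), if_neg (by omega),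
      Nat.add_sub_cancel]

/-- **Green's numerical lemma** (the "purely numerical argument" closing the proof of
Thm. 4.2.12): for `n ≥ 2` and `0 < b ≤ a`, if `b ≤ b_⟨n⟩ + (a - b)_⟨n-1⟩` then `b ≤ a_⟨n⟩`.
[cite: BrunsHerzog1998, Thm. 4.2.12 (proof, last paragraph)] -/
theorem le_lower_of_le_lower_add_lower {m a b : ℕ} (hm : 1 ≤ m) (hb : 0 < b) (hba : b ≤ a)
    (hyp : b ≤ lower (m + 1) b + lower m (a - b)) : b ≤ lower (m + 1) a := by
  classical
  by_contra hlt
  push Not at hlt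
  have hk := isRep_coeff (d := m + 1) (by omega) b
  set k := coeff (m + 1) b with hk_def
  -- the top coefficient is `≥ m + 1` since `b > 0`
  have hkn : m + 1 ≤ k (m + 1) := by
    by_contra hlt'
    push Not at hlt'
    have h0 := hk.eq_pred_of_lt le_rfl hlt'
    have : val (m + 1) k = 0 := Finset.sum_eq_zero fun i hi =>
      Nat.choose_eq_zero_of_lt (by
        rw [h0 i (mem_Icc.mp hi).1 (mem_Icc.mp hi).2]; have := (mem_Icc.mp hi).1; omega)
    rw [hk.val_eq] at this
    omega
  -- the truncation index `j`: least `i ≥ 1` with `i ≤ k i`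
  obtain ⟨j, hj1, hjk, hjn, hlow⟩ : ∃ j, 1 ≤ j ∧ j ≤ k j ∧ j ≤ m + 1 ∧
      ∀ i, 1 ≤ i → i < j → k i < i := by
    have hex : ∃ i, 1 ≤ i ∧ i ≤ k i := ⟨m + 1, by omega, hkn⟩
    refine ⟨Nat.find hex, (Nat.find_spec hex).1, (Nat.find_spec hex).2,
      Nat.find_min' hex ⟨by omega, hkn⟩, fun i hi hij => ?_⟩
    by_contra hge
    push Not at hge
    exact absurd (Nat.find_min' hex ⟨hi, hge⟩) (by omega)
  have hlow' : ∀ i, 1 ≤ i → i < j → k i = i - 1 := fun i hi hij =>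
    hk.eq_pred_of_lt (j := j - 1) (by omega) (hlow (j - 1) (by omega) (by omega)) i hi (by omega)
  have hge : ∀ i, j ≤ i → i ≤ m + 1 → i ≤ k i := by
    intro i hji hin
    have := hk.add_le hj1 hji hin
    omega
  -- Step 1: `a < A := val (m+1) K`, `K i = k i + 1` from `j` on: otherwise `a_⟨⟩ ≥ A_⟨⟩ = b`
  let K : ℕ → ℕ := fun i => if i < j then i - 1 else k i + 1
  have hKlow : ∀ i, i < j → K i = i - 1 := fun i hi => by simp only [K, if_pos hi]
  have hKtop : ∀ i, j ≤ i → K i = k i + 1 := fun i hi => by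
    simp only [K, if_neg (show ¬i < j by omega)]
  have hK : IsRep (m + 1) (val (m + 1) K) K := ⟨fun i hi hin => by
    rcases Nat.lt_or_ge (i + 1) j with h1 | h1
    · rw [hKlow i (by omega), hKlow (i + 1) h1]; omega
    rcases Nat.lt_or_ge i j with h2 | h2
    · rw [hKlow i h2, hKtop (i + 1) h1]; have := hge (i + 1) h1 (by omega); omega
    · rw [hKtop i h2, hKtop (i + 1) h1]; have := hk.lt i hi hin; omega, rfl⟩
  have hKlower : lower (m + 1) (val (m + 1) K) = b := by
    rw [hK.lower_eq, ← hk.val_eq, val]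
    exact Finset.sum_congr rfl fun i hi => by
      have hi1 := (mem_Icc.mp hi).1
      rcases Nat.lt_or_ge i j with h2 | h2
      · rw [hKlow i h2, hlow' i hi1 h2, Nat.choose_eq_zero_of_lt (by omega),
          Nat.choose_eq_zero_of_lt (by omega)]
      · rw [hKtop i h2, Nat.add_sub_cancel]
  have haA : a < val (m + 1) K := by
    by_contra hle
    push Not at hle
    have := lower_mono (m + 1) hle
    rw [hKlower] at this
    omega
  -- Step 2: `A = b + D + [j = 1]` with `D = val m L`, `L i' = k (i'+1)` from `j - 1` on
  let L : ℕ → ℕ := fun i => if i + 1 < j then i - 1 else k (i + 1)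
  have hLlow : ∀ i, i + 1 < j → L i = i - 1 := fun i hi => by simp only [L, if_pos hi]
  have hLtop : ∀ i, j ≤ i + 1 → L i = k (i + 1) := fun i hi => by
    simp only [L, if_neg (show ¬i + 1 < j by omega)]
  have hL : IsRep m (val m L) L := ⟨fun i hi hin => by
    rcases Nat.lt_or_ge (i + 1 + 1) j with h1 | h1
    · rw [hLlow i (by omega), hLlow (i + 1) h1]; omega
    rcases Nat.lt_or_ge (i + 1) j with h2 | h2
    · rw [hLlow i h2, hLtop (i + 1) h1]; have := hge (i + 1 + 1) h1 (by omega); omega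
    · rw [hLtop i h2, hLtop (i + 1) h1]; exact hk.lt (i + 1) (by omega) (by omega), rfl⟩
  -- the indicator `[j = 1]` as a sum over `[1, m+1]` concentrated at `i = 1`
  have hind : (if j = 1 then 1 else 0) =
      ∑ i ∈ Icc 1 (m + 1), (if 1 = i then (if j = 1 then 1 else 0) else 0) := by
    rw [Finset.sum_ite_eq, if_pos (mem_Icc.mpr ⟨le_rfl, by omega⟩)]
  have hsum : val (m + 1) K = b + val m L + (if j = 1 then 1 else 0) := by
    rw [hind, val, val, sum_Icc_shift m]
    conv_rhs => rw [← hk.val_eq, val]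
    rw [← Finset.sum_add_distrib, ← Finset.sum_add_distrib]
    refine Finset.sum_congr rfl fun i hi => ?_
    have hi1 := (mem_Icc.mp hi).1
    by_cases hi_eq : 1 = i
    · subst hi_eq
      rw [if_pos rfl, if_pos rfl, add_zero]
      by_cases hj1 : j = 1
      · rw [if_pos hj1, hKtop 1 (by omega), Nat.choose_one_right, Nat.choose_one_right]
      · rw [if_neg hj1, hKlow 1 (by omega), hlow' 1 le_rfl (by omega)]
        simp
    · rw [if_neg hi_eq, if_neg hi_eq, add_zero]
      rcases Nat.lt_or_ge i j with h2 | h2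
      · rw [hKlow i h2, hlow' i hi1 h2, hLlow (i - 1) (by omega),
          Nat.choose_eq_zero_of_lt (show i - 1 < i by omega),
          Nat.choose_eq_zero_of_lt (show i - 1 - 1 < i - 1 by omega)]
      · rw [hKtop i h2, hLtop (i - 1) (by omega), show i - 1 + 1 = i by omega]
        obtain ⟨i₀, rfl⟩ : ∃ i₀, i = i₀ + 1 + 1 := ⟨i - 2, by omega⟩
        rw [Nat.choose_succ_succ' (k (i₀ + 1 + 1)) (i₀ + 1), show i₀ + 1 + 1 - 1 = i₀ + 1 by omega]
        ring
  -- Step 3: `b_⟨m+1⟩ + D_⟨m⟩ + [j = 1] = b`, termwise by Pascal again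
  have hsum' : lower (m + 1) b + lower m (val m L) + (if j = 1 then 1 else 0) = b := by
    rw [hind, hk.lower_eq, hL.lower_eq, sum_Icc_shift m]
    conv_rhs => rw [← hk.val_eq, val]
    rw [← Finset.sum_add_distrib, ← Finset.sum_add_distrib]
    refine Finset.sum_congr rfl fun i hi => ?_
    have hi1 := (mem_Icc.mp hi).1
    by_cases hi_eq : 1 = i
    · subst hi_eq
      rw [if_pos rfl, if_pos rfl, add_zero]
      by_cases hj1 : j = 1
      · rw [if_pos hj1, Nat.choose_one_right, Nat.choose_one_right]
        have : 1 ≤ k 1 := by rw [hj1] at hjk; exact hjk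
        omega
      · rw [if_neg hj1, hlow' 1 le_rfl (by omega)]
        simp
    · rw [if_neg hi_eq, if_neg hi_eq, add_zero]
      rcases Nat.lt_or_ge i j with h2 | h2
      · rw [hlow' i hi1 h2, hLlow (i - 1) (by omega),
          Nat.choose_eq_zero_of_lt (show i - 1 - 1 < i by omega),
          Nat.choose_eq_zero_of_lt (show i - 1 - 1 - 1 < i - 1 by omega),
          Nat.choose_eq_zero_of_lt (show i - 1 < i by omega)]
      · rw [hLtop (i - 1) (by omega), show i - 1 + 1 = i by omega]
        have hki : 1 ≤ k i := by have := hge i h2 (mem_Icc.mp hi).2; omega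
        obtain ⟨i₀, rfl⟩ : ∃ i₀, i = i₀ + 1 + 1 := ⟨i - 2, by omega⟩
        obtain ⟨e, he⟩ : ∃ e, k (i₀ + 1 + 1) = e + 1 := ⟨k (i₀ + 1 + 1) - 1, by omega⟩
        rw [he, Nat.add_sub_cancel, show i₀ + 1 + 1 - 1 = i₀ + 1 by omega,
          Nat.choose_succ_succ' e (i₀ + 1)]
        ring
  -- Step 4: the contradiction
  by_cases hj1 : j = 1
  · -- `a - b ≤ D`, so `(a-b)_ ≤ D_` and `b ≤ b_ + D_ = b - 1`
    rw [if_pos hj1] at hsum hsum'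
    have h1 : a - b ≤ val m L := by omega
    have h2 := lower_mono m h1
    omega
  · -- `a - b ≤ D - 1`, and `(D - 1)_ + 1 = D_` by Lemma 4.2.11 (b) at the index `j - 1`
    rw [if_neg hj1] at hsum hsum'
    have h1 : a - b ≤ val m L - 1 := by omega
    have h2 := lower_mono m h1
    have h3 : lower m (val m L - 1) + 1 = lower m (val m L) :=
      hL.lower_pred_add_one (j := j - 1) (by omega) (by omega)
        (fun i hi hij => by rw [hLlow i (by omega)]; omega)
        (by rw [hLtop (j - 1) (by omega), show j - 1 + 1 = j by omega]; omega)
    omega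

/-! ## Gotzmann-form polynomials: `P(n)^⟨n⟩ = P(n + 1)` -/

/-- **A numerical polynomial in Gotzmann form**:
`P(n) = C(n + a₁, a₁) + C(n + a₂ - 1, a₂) + ⋯ + C(n + a_s - (s-1), a_s)` with exponents
`e i = aᵢ` (the unique form of the Hilbert polynomial of a homogeneous algebra, Bruns–Herzog
Thm. 4.3.2 / Exercise 4.2.17). [cite: BrunsHerzog1998, Thm. 4.3.2 (statement)] -/
def gotzmann (s : ℕ) (e : ℕ → ℕ) (n : ℕ) : ℕ := ∑ i ∈ Icc 1 s, (n + e i - (i - 1)).choose (e i)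

/-- Reflecting a sum over `[1, s]` into `[n + 1 - s, n]` (`s ≤ n`). [folklore] -/
private theorem sum_Icc_reflect {s n : ℕ} (hs : s ≤ n) (f : ℕ → ℕ) :
    ∑ i ∈ Icc 1 s, f (n + 1 - i) = ∑ r ∈ Icc (n + 1 - s) n, f r := by
  induction s with
  | zero => simp
  | succ s ih =>
    rw [Finset.sum_Icc_succ_top (by omega), ih (by omega),
      show n + 1 - (s + 1) = n - s by omega,
      ← Finset.insert_Icc_add_one_left_eq_Icc (show n - s ≤ n by omega),
      Finset.sum_insert (by simp), show n - s + 1 = n + 1 - s by omega, add_comm]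

/-- For `i ≤ n + 1` the Gotzmann term is a Macaulay term:
`C(n + eᵢ - (i - 1), eᵢ) = C((n + 1 - i) + eᵢ, n + 1 - i)`. [cite: BrunsHerzog1998, Thm. 4.3.2 (proof)] -/
theorem gotzmann_term_eq {n i : ℕ} (hi1 : 1 ≤ i) (hi : i ≤ n + 1) (a : ℕ) :
    (n + a - (i - 1)).choose a = (n + 1 - i + a).choose (n + 1 - i) := by
  rw [show n + a - (i - 1) = n + 1 - i + a by omega]
  exact Nat.choose_symm_of_eq_add (by omega)

/-- The Gotzmann sum written as a Macaulay-shaped sum over the bottom indices `r = n + 1 - i`.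
[cite: BrunsHerzog1998, Thm. 4.3.2 (proof)] -/
theorem gotzmann_eq_sum_Icc {s n : ℕ} (hs : s ≤ n) (e : ℕ → ℕ) :
    gotzmann s e n = ∑ r ∈ Icc (n + 1 - s) n, (r + e (n + 1 - r)).choose r := by
  rw [gotzmann, ← sum_Icc_reflect hs fun r => (r + e (n + 1 - r)).choose r]
  refine Finset.sum_congr rfl fun i hi => ?_
  have hi1 := (mem_Icc.mp hi).1
  have his := (mem_Icc.mp hi).2
  rw [gotzmann_term_eq hi1 (by omega), show n + 1 - (n + 1 - i) = i by omega]

/-- **The Macaulay representation of a Gotzmann-form value**: for `s ≤ n` and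
`a₁ ≥ a₂ ≥ ⋯ ≥ a_s`, the `n`-th Macaulay coefficients of `P(n)` are `k(r) = r + a_{n+1-r}`
for `r > n - s` and `k(r) = r - 1` (vanishing terms) for `r ≤ n - s` (Bruns–Herzog, proof of
Thm. 4.3.2: "the right hand side `b` of this inequality satisfies
`b = C(n + a₁, n) + C(n + a₂ - 1, n - 1) + ⋯`"). [cite: BrunsHerzog1998, Thm. 4.3.2 (proof)] -/
theorem isRep_gotzmann {s n : ℕ} (hs : s ≤ n) {e : ℕ → ℕ}
    (he : ∀ i, 1 ≤ i → i < s → e (i + 1) ≤ e i) :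
    IsRep n (gotzmann s e n) fun r => if n - s < r then r + e (n + 1 - r) else r - 1 := by
  refine ⟨fun r hr hrn => ?_, ?_⟩
  · by_cases h1 : n - s < r
    · rw [if_pos h1, if_pos (by omega), show n + 1 - r = (n - r) + 1 by omega,
        show n + 1 - (r + 1) = n - r by omega]
      have := he (n - r) (by omega) (by omega)
      omega
    · rw [if_neg h1]
      by_cases h2 : n - s < r + 1
      · rw [if_pos h2]; omega
      · rw [if_neg h2]; omega
  · rw [val, gotzmann_eq_sum_Icc hs, sum_Icc_split (show n - s ≤ n by omega),
      Finset.sum_eq_zero fun r hr => by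
        rw [if_neg (by have := (mem_Icc.mp hr).2; omega)]
        exact Nat.choose_eq_zero_of_lt (by have := (mem_Icc.mp hr).1; omega),
      zero_add, show n - s + 1 = n + 1 - s by omega]
    exact Finset.sum_congr rfl fun r hr => by rw [if_pos (by have := (mem_Icc.mp hr).1; omega)]

/-- **`P(n)^⟨n⟩ = P(n + 1)` for a polynomial in Gotzmann form** (`s ≤ n`,
`a₁ ≥ ⋯ ≥ a_s`): the identity behind Bruns–Herzog Cor. 4.2.14 / Thm. 4.3.2 ("we have
`P_R(j-2)^⟨j-2⟩ = P_R(j-1)`") and Gotzmann's persistence; the input that makes ONE degree of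
maximal growth propagate to all higher degrees. [cite: BrunsHerzog1998, Thm. 4.3.2 (proof)] -/
theorem upper_gotzmann {s n : ℕ} (hs : s ≤ n) {e : ℕ → ℕ}
    (he : ∀ i, 1 ≤ i → i < s → e (i + 1) ≤ e i) :
    upper n (gotzmann s e n) = gotzmann s e (n + 1) := by
  rw [(isRep_gotzmann hs he).upper_eq, gotzmann_eq_sum_Icc (show s ≤ n + 1 by omega),
    sum_Icc_split (show n - s ≤ n by omega),
    Finset.sum_eq_zero fun r hr => by
      rw [if_neg (by have := (mem_Icc.mp hr).2; omega)]
      exact Nat.choose_eq_zero_of_lt (by have := (mem_Icc.mp hr).1; omega),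
    zero_add, show n + 1 + 1 - s = (n - s + 1) + 1 by omega, ← Finset.map_add_right_Icc,
    Finset.sum_map]
  refine Finset.sum_congr rfl fun r hr => ?_
  have hr1 := (mem_Icc.mp hr).1
  have hr2 := (mem_Icc.mp hr).2
  rw [if_pos (by omega)]
  simp only [addRightEmbedding_apply]
  rw [show n + 1 + 1 - (r + 1) = n + 1 - r by omega]
  ring_nf

/-- The same for `a_⟨n⟩`: **`P(n)_⟨n⟩ = Σ C(n + bᵢ - (i-1), bᵢ)` with `bᵢ = aᵢ - 1`**, provided
all `aᵢ ≥ 1` (Bruns–Herzog, proof of Thm. 4.3.2: "`b_⟨n⟩ = C(n + b₁, n) + ⋯`", `aᵢ = bᵢ + 1`).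
[cite: BrunsHerzog1998, Thm. 4.3.2 (proof)] -/
theorem lower_gotzmann {s n : ℕ} (hs : s ≤ n) {e : ℕ → ℕ}
    (he : ∀ i, 1 ≤ i → i < s → e (i + 1) ≤ e i) (he1 : ∀ i, 1 ≤ i → i ≤ s → 1 ≤ e i) :
    lower n (gotzmann s e n) = gotzmann s (fun i => e i - 1) n := by
  rw [(isRep_gotzmann hs he).lower_eq, gotzmann_eq_sum_Icc hs,
    sum_Icc_split (show n - s ≤ n by omega),
    Finset.sum_eq_zero fun r hr => by
      rw [if_neg (by have := (mem_Icc.mp hr).2; omega)]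
      exact Nat.choose_eq_zero_of_lt (by have := (mem_Icc.mp hr).1; omega),
    zero_add, show n - s + 1 = n + 1 - s by omega]
  refine Finset.sum_congr rfl fun r hr => ?_
  have hr1 := (mem_Icc.mp hr).1
  rw [if_pos (by omega)]
  have := he1 (n + 1 - r) (by have := (mem_Icc.mp hr).2; omega) (by omega)
  congr 1
  omega

end Macaulay

end Literature.RingTheory.GradedAlgebra
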